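import Summits.QuantumFields.BalabanUV.T4Continuum.Spine.NE3.TangentProjectionSlicB8
import Summits.QuantumFields.BalabanUV.T4Continuum.Support.NE3ClassRadiusFamily
import HarnessLib

/-!
# T⁴ programme, node NE3 — census row R25 over `sfClass`: the tangent projection bound on `slicB8` at the background `W = cavg L U_B` of a
# regular run-B configuration — the END's per-pair binder `hproj`, DISCHARGED with one k-free constant

Cell `pub-balaban-gaps` (YM blitz, track G2, seat `ne3`, unit `pub-balaban-gaps-ne3`; writer prover-pub-balaban-gaps-ne3-g4-0, 2026-08-23), repair R25 of
`run/shared/lean/pub/pub-balaban-gaps/ne/NE3.md` §4, file 2∕2.  File 1 (`Spine/NE3/TangentProjectionSlicB8`) proved the k-free TANGENT PROJECTION BOUND on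
B8's slice at every unitary periodic background of the tower's small-field class (corner-spike gauge correction, `K = 1 + √(192·(d·L)·(d + #(Plane d)))`).
THIS FILE reads it over `sfClass`: for a `(b, g)`-regular run-B configuration `U_B` at level `j+2` the background `W = cavg L U_B` lies in `sfClass (j+1)`
(`MinimalActionRate.rescale_bavg_mem_sfClass`: unitary, `(N·L^{j+1})`-periodic, small field of radius `ε∕(L^{j+1})²`), the multi-level smallness one level up
comes from the same two k-free ε-lines as `NE3ClassRadiusFamily.levelSmall_family`, and `ε∕(L^{j+1})²·L^{j+1} ≤ ε ≤ 1` — so the binder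
`hproj : TangentProjectionBound L (j+1) (cavg L U_B) (slicB8 …) {skew ∧ periodic ∧ TangentIter L j (cavg L U_B)} K (periodBox (N·L^{j+1}))` of
`PairLandauB8EndSfClass.ne3EnergyRateWCov_sfClass_of_pairLandauGaugeB8Avg` holds at EVERY pair with ONE constant.

CONTENT (all [folklore]; 0 sorry; 0 def): `levelSmall_family_background` (`∀ j, LevelSmall d L j (ε∕(L^{j+1})²)` from the two ε-lines),
**`tangentProjectionBound_slicB8_sfClass`** (per level, from `LevelSmall d L j (ε∕(L^{j+1})²)`), **`tangentProjectionBound_slicB8_sfClass_family`** (all levels).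

HONEST FRAMING.  Lattice kinematics on OUR typed objects; ONE displayed hypothesis of the `sfClass` END on B8's surface is discharged, nothing else; (P♮) on
`slicB8` ([Balaban1985BackgroundPropagators] Thm 3.3 TYPE), `PairLandauGaugeB8Avg` ([Balaban1985RegularSpaces] Thm 2 ∘ [Balaban1985Variational] Thm 1 TYPE), the
supplier's sup currencies, the covariant root and **NE3 are NOT proved**; spine PROVED 0∕9; finite T⁴ rung (B)+1 — NOT continuum YM on ℝ⁴, NOT infinite volume,
NOT mass gap, NOT `BetaPertH`, NOT Clay.  ABSOLUTE RULE kept (no printed sentence is a hypothesis).  PLACEMENT: `Summits/QuantumFields/BalabanUV/T4Continuum/Spine/NE3/`.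
-/

set_option autoImplicit false

open scoped BigOperators Matrix Matrix.Norms.L2Operator
open Finset

namespace Summit.QuantumFields.BalabanUV.T4Continuum.NE3.TangentProjectionSlicB8Class

open Literature.MathematicalPhysics.QuantumFieldTheory.Balaban1983to89
open B7Prop1Explicit B7Prop2Explicit
open T4AveragingDeficitWall (IsUnitaryCfg IsSkewDir SmallField)
open T4AveragingDeficitWallBoundary (IsPeriodicCfg periodBox)
open AveragingDeficitPeriodicCounting (IsPeriodicDir)
open AveragingDeficitChartCalculus (cavg)
open AveragingDeficitMultiLevelPrep (TangentIter LevelSmall)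
open AveragingDeficitTwoLevelPrep (twoLevelSmall)
open MinimalActionRate (Regular sfClass rescale_bavg_mem_sfClass)
open NE3ClassRadiusFamily (levelSmall_of_small)
open NE3CurlPairedResidualGaugeQuotient (TangentProjectionBound)
open NE3.PairLandauB8Avg (slicB8)
open NE3.TangentProjectionSlicB8 (tangentProjectionBound_slicB8)

noncomputable section

variable {d : ℕ} {n : Type*} [Fintype n] [DecidableEq n]

/-! ## §1 The class-radius family one level up; §2 the bound over `sfClass` -/

/-- The class-radius family ONE LEVEL UP, from the same two k-free ε-lines as `NE3ClassRadiusFamily.levelSmall_family` (`L ≥ 2`, `ε ≥ 0`):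
`∀ j, LevelSmall d L j (ε∕(L^{j+1})²)` (`(L²)^j·ε∕(L^{j+1})² = ε∕L²`; `levelSmall_of_small`). [folklore] -/
theorem levelSmall_family_background {L : ℕ} (hL : 2 ≤ L) {ε : ℝ} (hε : 0 ≤ ε)
    (h1 : 16 * (14464 * ((d : ℝ) + 1) ^ 2 * ((d : ℝ) + 4) ^ 2) * ε ≤ 3)
    (h2 : 2 * twoLevelSmall d L * ε ≤ (L : ℝ) ^ 2) :
    ∀ j : ℕ, LevelSmall d L j (ε / ((L : ℝ) ^ (j + 1)) ^ 2) := by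
  intro j
  have hL0 : (0 : ℝ) < L := by exact_mod_cast (show 0 < L by omega)
  have hL2pos : (0 : ℝ) < (L : ℝ) ^ 2 := by positivity
  have key : ((L : ℝ) ^ 2) ^ j * (ε / ((L : ℝ) ^ (j + 1)) ^ 2) = ε / (L : ℝ) ^ 2 := by
    have hne : ((L : ℝ) ^ (j + 1)) ^ 2 ≠ 0 := by positivity
    have hne2 : (L : ℝ) ^ 2 ≠ 0 := by positivity
    field_simp
    ring
  apply levelSmall_of_small hL j (by positivity)
  · rw [key]
    have e : 14464 * ((d : ℝ) + 1) ^ 2 * ((d : ℝ) + 4) ^ 2 * (L : ℝ) ^ 2 * (8 / 3 * (ε / (L : ℝ) ^ 2))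
        = 8 / 3 * (14464 * ((d : ℝ) + 1) ^ 2 * ((d : ℝ) + 4) ^ 2) * ε := by
      field_simp
    rw [e]
    linarith
  · rw [key]
    have e : 2 * twoLevelSmall d L * (ε / (L : ℝ) ^ 2) = (2 * twoLevelSmall d L * ε) / (L : ℝ) ^ 2 := by ring
    rw [e, div_le_one hL2pos]
    exact h2

/-- **R25 OVER `sfClass` — THE END's PER-PAIR HYPOTHESIS, DISCHARGED** (`3 ≤ d`, `2 ≤ L`, `1 ≤ N`, `0 ≤ b`, `ε ≤ 1`, the two class lines `hbs`∕`hbε'` of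
`MinimalActionRate.rescale_bavg_mem_sfClass`, and `LevelSmall d L j (ε∕(L^{j+1})²)`): for every `(b, g)`-regular run-B configuration `U_B` at level `j+2` the
background `W = cavg L U_B` carries
`TangentProjectionBound L (j+1) W (slicB8 L N (j+1) W) {skew ∧ (N·L^{j+1})-periodic ∧ TangentIter L j W} (1 + √(192·(d·L)·(d + #(Plane d)))) (periodBox (N·L^{j+1}))`
— literally the binder `hproj` of `PairLandauB8EndSfClass.ne3EnergyRateWCov_sfClass_of_pairLandauGaugeB8Avg` (through `curlPairedResidual_sfClass_of_tangentProjection`),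
with a k-FREE, N-FREE, pair-free constant.  (`W ∈ sfClass (j+1)`: unitary, periodic, small field of radius `ε∕(L^{j+1})²`, and `ε∕(L^{j+1})²·L^{j+1} ≤ ε ≤ 1`.)
[folklore] -/
theorem tangentProjectionBound_slicB8_sfClass [Nonempty n] (hd : 3 ≤ d) {L N : ℕ} [NeZero N] (hL : 2 ≤ L) (hN : 1 ≤ N)
    {ε b g : ℝ} (hb : 0 ≤ b) (hε1 : ε ≤ 1)
    (hbs : 512 * (d + 1) * (d + 4) * (L : ℝ) ^ 2 * b ≤ 1) (hbε' : b + 226 * (8 * (d + 1) * (d + 4)) ^ 2 * b ^ 2 ≤ ε)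
    (j : ℕ) (hsmj : LevelSmall d L j (ε / ((L : ℝ) ^ (j + 1)) ^ 2))
    {UB : Site d → Fin d → (Matrix n n ℂ)ˣ} (hreg : Regular d L N b g (j + 2) UB) :
    TangentProjectionBound L (j + 1) (cavg L UB) (slicB8 L N (j + 1) (cavg L UB))
      {Y | IsSkewDir Y ∧ IsPeriodicDir Y ((N * L ^ (j + 1) : ℕ) : ℤ) ∧ TangentIter L j (cavg L UB) Y}
      (1 + Real.sqrt (192 * ((d : ℝ) * L) * (d + Fintype.card (T4AveragingDeficitWall.Plane d))))
      (periodBox (N * L ^ (j + 1))) := by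
  have hL1 : 1 ≤ L := by omega
  have hcl : cavg L UB ∈ sfClass d L N ε (j + 1) := rescale_bavg_mem_sfClass hL1 hb hbs hbε' hreg
  obtain ⟨hWu, hWP, hWx⟩ := hcl
  have hε : 0 ≤ ε := by nlinarith [sq_nonneg b]
  have hLpow : (1 : ℝ) ≤ (L : ℝ) ^ (j + 1) := one_le_pow₀ (by exact_mod_cast hL1)
  have hLpos : (0 : ℝ) < (L : ℝ) ^ (j + 1) := by positivity
  have hx : 0 ≤ ε / ((L : ℝ) ^ (j + 1)) ^ 2 := by positivity
  have hxM : ε / ((L : ℝ) ^ (j + 1)) ^ 2 * (L : ℝ) ^ (j + 1) ≤ 1 := by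
    have e : ε / ((L : ℝ) ^ (j + 1)) ^ 2 * (L : ℝ) ^ (j + 1) = ε / (L : ℝ) ^ (j + 1) := by
      field_simp
    rw [e]
    exact (div_le_one hLpos).mpr (hε1.trans hLpow)
  exact tangentProjectionBound_slicB8 hd hL hN j hWu hWP hx hsmj hWx hxM

/-- **R25 OVER `sfClass`, FAMILY FORM**: with the two k-free ε-lines of the class-radius family (`levelSmall_family_background`) the bound holds at
EVERY level `j` and every `(b, g)`-regular run-B configuration, with ONE constant. [folklore] -/
theorem tangentProjectionBound_slicB8_sfClass_family [Nonempty n] (hd : 3 ≤ d) {L N : ℕ} [NeZero N] (hL : 2 ≤ L) (hN : 1 ≤ N)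
    {ε b g : ℝ} (hb : 0 ≤ b) (hε : 0 ≤ ε) (hε1 : ε ≤ 1)
    (hbs : 512 * (d + 1) * (d + 4) * (L : ℝ) ^ 2 * b ≤ 1) (hbε' : b + 226 * (8 * (d + 1) * (d + 4)) ^ 2 * b ^ 2 ≤ ε)
    (h1 : 16 * (14464 * ((d : ℝ) + 1) ^ 2 * ((d : ℝ) + 4) ^ 2) * ε ≤ 3) (h2 : 2 * twoLevelSmall d L * ε ≤ (L : ℝ) ^ 2)
    (j : ℕ) {UB : Site d → Fin d → (Matrix n n ℂ)ˣ} (hreg : Regular d L N b g (j + 2) UB) :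
    TangentProjectionBound L (j + 1) (cavg L UB) (slicB8 L N (j + 1) (cavg L UB))
      {Y | IsSkewDir Y ∧ IsPeriodicDir Y ((N * L ^ (j + 1) : ℕ) : ℤ) ∧ TangentIter L j (cavg L UB) Y}
      (1 + Real.sqrt (192 * ((d : ℝ) * L) * (d + Fintype.card (T4AveragingDeficitWall.Plane d))))
      (periodBox (N * L ^ (j + 1))) :=
  tangentProjectionBound_slicB8_sfClass hd hL hN hb hε1 hbs hbε' j (levelSmall_family_background hL hε h1 h2 j) hreg

end

end Summit.QuantumFields.BalabanUV.T4Continuum.NE3.TangentProjectionSlicB8Class
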